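import Summits.AtomisticToContinuum.FouriersLaw.Theorems.HonestZwanzigPositiveMemoryUpperLimit

/-!
# HonestZwanzig / PositiveMemory — the Gram form of the bond memory kernel (line `Sketch`, Stub MG)

Support file for item `stmt-AtomisticToContinuum-12694` (`PositiveMemory` of route `HonestZwanzig`,
sub-problem `FouriersLaw`). At every fixed `N` and fixed Laplace variable `s > 0` the bond memory
kernel `𝔎_N(s)_{bb'} = schur_s(j_b, j_{b'})` (the resolvent of Zwanzig's orthogonal dynamics between
two bond currents) splits as

  `schur_s(j_b, j_{b'}) = lap_s(j_b, j_{b'}) + Γ(s)_{bb'}`,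
  `Γ(s)_{bb'} = Σ_{x,y} a_{b,x} (G(s)⁻¹)_{xy} a_{b',y}`, `a_{b,x} = lap_s(j_b, e_x)`,

and the correction `Γ(s)` is a positive semidefinite matrix.

* `gram_schur`: the abstract first identity, from `schur = lap − lap(·,e)G⁻¹lap(e,·)` and the time
  reversal `lap(e_x, j_b) = −lap(j_b, e_x)`.
* `gram_form_nonneg`: `Σ_{b,b'} v_b (a_b^T M a_{b'}) v_{b'} ≥ 0` for a positive semidefinite `M`
  (it is the quadratic form of `A M Aᵀ`, `Matrix.PosSemidef.mul_mul_conjTranspose_same`).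
* `pkg_rev_bond`: `lap_s(e_x, j_b) = −lap_s(j_b, e_x)` for the canonical objects (the site energy is
  even and the bond current odd in the momenta; `FeshbachIdentities` (ii)), the single-bond version
  of `NetworkReduction.pkg_rev`.
* `fixedN_memoryGram`: the canonical instance (`pkg_G_symm`, `FeshbachIdentities` (iv),
  `posDef_of_symm_of_pos`, `Matrix.PosDef.inv`).
* `stub_memoryGram`: the registered stub of line `Sketch`, obtained by instantiating the gadgets
  by `rfl`.
-/

noncomputable section

open MeasureTheory Finset Real Set Filter Topology
open Literature.MathematicalPhysics.KineticTheory.HeatConduction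
open Summit.AtomisticToContinuum.FouriersLaw.Theorems.HonestZwanzig.NetworkReduction

namespace Summit.AtomisticToContinuum.FouriersLaw.Theorems.HonestZwanzig.PositiveMemory

/-! ### The abstract identities at one fixed `s` -/

section Gram

open Matrix

variable {X : Type*} {N : ℕ}

/-- **The Schur complement between two odd observables** (abstract pairings at one fixed `s`). If
`schur(f,g) = lap(f,g) − Σ_{x,y} lap(f,e_x) Gi_{xy} lap(e_y,g)` and `lap(e_x, j_b) = −lap(j_b, e_x)`
(time reversal), then `schur(j_b, j_{b'}) = lap(j_b, j_{b'}) + Σ_{x,y} lap(j_b,e_x) Gi_{xy} lap(j_{b'},e_y)`. -/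
theorem gram_schur (lap schur : (X → ℝ) → (X → ℝ) → ℝ) (e j : Fin N → X → ℝ)
    (Gi : Matrix (Fin N) (Fin N) ℝ)
    (hschur : ∀ f g, schur f g = lap f g - ∑ x, ∑ y, lap f (e x) * Gi x y * lap (e y) g)
    (hrev : ∀ x b, lap (e x) (j b) = -lap (j b) (e x)) (b b' : Fin N) :
    schur (j b) (j b') =
      lap (j b) (j b') + ∑ x, ∑ y, lap (j b) (e x) * Gi x y * lap (j b') (e y) := by
  rw [hschur, sub_eq_add_neg, ← Finset.sum_neg_distrib]
  congr 1
  refine Finset.sum_congr rfl fun x _ => ?_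
  rw [← Finset.sum_neg_distrib]
  refine Finset.sum_congr rfl fun y _ => ?_
  rw [hrev]
  ring

/-- **The Gram form is positive semidefinite.** For a positive semidefinite real matrix `M` and any
family of vectors `a_b`, the matrix `Γ_{bb'} = Σ_{x,y} a_{b,x} M_{xy} a_{b',y}` (`= (A M Aᵀ)_{bb'}`)
has a nonnegative quadratic form. -/
theorem gram_form_nonneg {m n : Type*} [Fintype m] [Fintype n] (M : Matrix n n ℝ)
    (hM : M.PosSemidef) (a : m → n → ℝ) (v : m → ℝ) :
    0 ≤ ∑ b, ∑ b', v b * (∑ x, ∑ y, a b x * M x y * a b' y) * v b' := by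
  set A : Matrix m n ℝ := Matrix.of a with hA
  have hΓ : (A * M * Aᵀ).PosSemidef := by
    have h := hM.mul_mul_conjTranspose_same A
    rwa [conjTranspose_eq_transpose_of_trivial] at h
  have hentry : ∀ b b', (∑ x, ∑ y, a b x * M x y * a b' y) = (A * M * Aᵀ) b b' := by
    intro b b'
    rw [Matrix.mul_apply, Finset.sum_comm]
    refine Finset.sum_congr rfl fun y _ => ?_
    rw [Matrix.mul_apply, Matrix.transpose_apply, Finset.sum_mul]
    rfl
  simp_rw [hentry]
  rw [sum_sum_eq_dotProduct_mulVec]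
  have h := hΓ.dotProduct_mulVec_nonneg v
  rwa [star_trivial] at h

end Gram

/-! ### The canonical objects at fixed `N` and fixed `s > 0` -/

section Package

variable {ω₂ lam β γ : ℝ} {N : ℕ} {T : ℝ}
  {Adm : (PhaseSpace N → ℝ) → Prop}
  {corr : (PhaseSpace N → ℝ) → (PhaseSpace N → ℝ) → ℝ → ℝ}
  {lap : ℝ → (PhaseSpace N → ℝ) → (PhaseSpace N → ℝ) → ℝ}
  {cov : (PhaseSpace N → ℝ) → (PhaseSpace N → ℝ) → ℝ}
  {e : Fin N → PhaseSpace N → ℝ}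
  (hAdm : ∀ f, Adm f ↔ (Continuous f ∧ ∃ A : ℝ, ∀ z,
    |f z| ≤ A * Real.exp ((pinnedChain ω₂ lam β γ).hamiltonian N z / (8 * T))))
  (hcorr : ∀ f g t, corr f g t =
    (∫ z, f z * (∫ y, g y ∂((pinnedChain ω₂ lam β γ).transitionKernel N T T t.toNNReal z))
      ∂(pinnedChain ω₂ lam β γ).gibbsMeasure N T) -
    (∫ z, f z ∂(pinnedChain ω₂ lam β γ).gibbsMeasure N T) *
      (∫ z, g z ∂(pinnedChain ω₂ lam β γ).gibbsMeasure N T))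
  (hlap : ∀ s f g, lap s f g = ∫ t in Set.Ioi (0 : ℝ), Real.exp (-(s * t)) * corr f g t)
  (he : ∀ x z, e x z = z.2 x ^ 2 / 2 + (pinnedChain ω₂ lam β γ).U (z.1 x) +
    ∑ j : Fin N, ((if j.val = x.val + 1 then (pinnedChain ω₂ lam β γ).V (z.1 j - z.1 x) / 2 else 0) +
      (if x.val = j.val + 1 then (pinnedChain ω₂ lam β γ).V (z.1 x - z.1 j) / 2 else 0)))
  (hFI : ∀ f g : PhaseSpace N → ℝ, Adm f → Adm g →
    Integrable f ((pinnedChain ω₂ lam β γ).gibbsMeasure N T) ∧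
    (∀ t : ℝ, 0 ≤ t → Integrable (fun z => f z *
      (∫ y, g y ∂((pinnedChain ω₂ lam β γ).transitionKernel N T T t.toNNReal z)))
      ((pinnedChain ω₂ lam β γ).gibbsMeasure N T)) ∧
    IntegrableOn (corr f g) (Set.Ioi 0) ∧
    (∀ t : ℝ, 0 ≤ t → corr f g t = corr (fun z => g (z.1, -z.2)) (fun z => f (z.1, -z.2)) t) ∧
    (∀ s : ℝ, 0 < s → ∀ x : Fin N,
      s * lap s (e x) g - cov (e x) g =
        lap s (fun z => (pinnedChain ω₂ lam β γ).generator N T T (e x) (z.1, -z.2)) g ∧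
      s * lap s f (e x) - cov f (e x) = lap s f ((pinnedChain ω₂ lam β γ).generator N T T (e x))))
  (hω : 0 < ω₂) (hl : 0 ≤ lam) (hβ : 0 ≤ β) (hT : 0 < T)

include hAdm hcorr hlap hFI he hω hl hβ hT in
/-- `lap_s(e_x, j_b) = −lap_s(j_b, e_x)` (time reversal `FeshbachIdentities` (ii); the site energy is
even and the bond current odd in the momenta). The single-bond version of `pkg_rev`. -/
theorem pkg_rev_bond (s : ℝ) (x b : Fin N) :
    lap s (e x) ((pinnedChain ω₂ lam β γ).bondCurrent N b) =
      -lap s ((pinnedChain ω₂ lam β γ).bondCurrent N b) (e x) := by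
  rw [lap_rev hlap hFI (adm_e Adm hAdm e he hω hl hβ hT x) (adm_bondCurrent Adm hAdm hω hl hβ hT b) s]
  have h1 : (fun z : PhaseSpace N => (pinnedChain ω₂ lam β γ).bondCurrent N b (z.1, -z.2)) =
      fun z => (-1) * (pinnedChain ω₂ lam β γ).bondCurrent N b z := by
    funext z
    rw [neg_one_mul]
    exact OscillatorChain.bondCurrent_neg_momentum _ N b z
  have h2 : (fun z : PhaseSpace N => e x (z.1, -z.2)) = e x := funext fun z => e_neg_momentum _ e he x z
  rw [h1, h2, lap_const_mul_left hcorr hlap]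
  ring

include hAdm hcorr hlap he hFI hω hl hβ hT in
/-- **The Gram form of the bond memory kernel at fixed `N`, `s > 0`.** With `a_{b,x} = lap_s(j_b, e_x)`
and `G(s) = [lap_s(e_x,e_y)]` symmetric (`pkg_G_symm`) positive definite (`FeshbachIdentities` (iv)):
`schur_s(j_b, j_{b'}) = lap_s(j_b, j_{b'}) + Σ_{x,y} a_{b,x} (G(s)⁻¹)_{xy} a_{b',y}` (time reversal,
`pkg_rev_bond`), and `[Σ_{x,y} a_{b,x} (G(s)⁻¹)_{xy} a_{b',y}]_{bb'}` is positive semidefinite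
(`G(s)⁻¹` is, `Matrix.PosDef.inv`). -/
theorem fixedN_memoryGram
    (G : ℝ → Matrix (Fin N) (Fin N) ℝ) (hG : ∀ s x y, G s x y = lap s (e x) (e y))
    (schur : ℝ → (PhaseSpace N → ℝ) → (PhaseSpace N → ℝ) → ℝ)
    (hschur : ∀ s f g, schur s f g = lap s f g - ∑ x, ∑ y, lap s f (e x) * (G s)⁻¹ x y * lap s (e y) g)
    (hGp : ∀ s : ℝ, 0 < s → ∀ v : Fin N → ℝ, v ≠ 0 → 0 < ∑ x, ∑ y, v x * G s x y * v y)
    {s : ℝ} (hs : 0 < s) :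
    (∀ b b' : Fin N, schur s ((pinnedChain ω₂ lam β γ).bondCurrent N b)
        ((pinnedChain ω₂ lam β γ).bondCurrent N b') =
      lap s ((pinnedChain ω₂ lam β γ).bondCurrent N b) ((pinnedChain ω₂ lam β γ).bondCurrent N b') +
        ∑ x, ∑ y, lap s ((pinnedChain ω₂ lam β γ).bondCurrent N b) (e x) * (G s)⁻¹ x y *
          lap s ((pinnedChain ω₂ lam β γ).bondCurrent N b') (e y)) ∧
    (∀ v : Fin N → ℝ, 0 ≤ ∑ b, ∑ b', v b *
      (∑ x, ∑ y, lap s ((pinnedChain ω₂ lam β γ).bondCurrent N b) (e x) * (G s)⁻¹ x y *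
        lap s ((pinnedChain ω₂ lam β γ).bondCurrent N b') (e y)) * v b') := by
  classical
  refine ⟨fun b b' => gram_schur (lap s) (schur s) e ((pinnedChain ω₂ lam β γ).bondCurrent N) (G s)⁻¹
    (hschur s) (fun x b => pkg_rev_bond hAdm hcorr hlap he hFI hω hl hβ hT s x b) b b', fun v => ?_⟩
  have hGsym : ∀ x y, G s x y = G s y x := fun x y => by
    rw [hG, hG, pkg_G_symm hAdm hlap he hFI hω hl hβ hT s x y]
  have hGpd : (G s).PosDef := posDef_of_symm_of_pos (G s) hGsym (hGp s hs)
  exact gram_form_nonneg (G s)⁻¹ hGpd.inv.posSemidef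
    (fun b x => lap s ((pinnedChain ω₂ lam β γ).bondCurrent N b) (e x)) v

end Package

/-! ### The registered stub -/

/-- **Stub MG — Gram form of the bond memory kernel** (registered; fixed `N`, `s > 0`): by time reversal
`lap_s(e_y, j_{b'}) = −lap_s(j_{b'}, e_y)`, so `schur_s(j_b, j_{b'}) = lap_s(j_b, j_{b'}) + Σ_{x,y} a_{b,x} (G(s)⁻¹)_{xy} a_{b',y}`
with `a_{b,x} = lap_s(j_b, e_x)`, and the correction `Γ(s)_{bb'} = a_bᵀG(s)⁻¹a_{b'}` is a positive semidefinite matrix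
(`G(s)` symmetric positive definite, `FeshbachIdentities` (iv)). -/
theorem stub_memoryGram :
    Summit.AtomisticToContinuum.FouriersLaw.Theses.HonestZwanzig.FeshbachIdentities →
    ∀ ω₂ lam β γ : ℝ, 0 < ω₂ → 0 < lam → 0 < β → 0 < γ → ∀ T : ℝ, 0 < T → ∀ N : ℕ, 2 ≤ N →
    let P := Literature.MathematicalPhysics.KineticTheory.HeatConduction.pinnedChain ω₂ lam β γ;
    let X := Literature.MathematicalPhysics.KineticTheory.HeatConduction.PhaseSpace N;
    let μ : MeasureTheory.Measure X := P.gibbsMeasure N T;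
    let corr : (X → ℝ) → (X → ℝ) → ℝ → ℝ := fun f g t =>
      (∫ z, f z * (∫ y, g y ∂(P.transitionKernel N T T t.toNNReal z)) ∂μ) - (∫ z, f z ∂μ) * (∫ z, g z ∂μ);
    let lap : ℝ → (X → ℝ) → (X → ℝ) → ℝ := fun s f g =>
      ∫ t in Set.Ioi (0 : ℝ), Real.exp (-(s * t)) * corr f g t;
    let e : Fin N → X → ℝ := fun x z => z.2 x ^ 2 / 2 + P.U (z.1 x) +
      ∑ j : Fin N, ((if j.val = x.val + 1 then P.V (z.1 j - z.1 x) / 2 else 0) +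
        (if x.val = j.val + 1 then P.V (z.1 x - z.1 j) / 2 else 0));
    let G : ℝ → Matrix (Fin N) (Fin N) ℝ := fun s => Matrix.of fun x y => lap s (e x) (e y);
    let schur : ℝ → (X → ℝ) → (X → ℝ) → ℝ := fun s f g =>
      lap s f g - ∑ x : Fin N, ∑ y : Fin N, lap s f (e x) * (G s)⁻¹ x y * lap s (e y) g;
    ∀ s : ℝ, 0 < s →
      (∀ b b' : Fin N, schur s (P.bondCurrent N b) (P.bondCurrent N b') =
        lap s (P.bondCurrent N b) (P.bondCurrent N b') +
          ∑ x : Fin N, ∑ y : Fin N, lap s (P.bondCurrent N b) (e x) * (G s)⁻¹ x y * lap s (P.bondCurrent N b') (e y)) ∧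
      (∀ v : Fin N → ℝ, 0 ≤ ∑ b : Fin N, ∑ b' : Fin N, v b *
        (∑ x : Fin N, ∑ y : Fin N, lap s (P.bondCurrent N b) (e x) * (G s)⁻¹ x y * lap s (P.bondCurrent N b') (e y)) * v b') := by
  intro hFI ω₂ lam β γ hω hl hβ hγ T hT N hN
  obtain ⟨-, hFI2, -, hGpos⟩ := hFI ω₂ lam β γ hω hl hβ hγ T hT N hN
  intro P X μ corr lap e G schur s hs
  exact fixedN_memoryGram (ω₂ := ω₂) (lam := lam) (β := β) (γ := γ) (N := N) (T := T)
    (cov := fun f g => (∫ z, f z * g z ∂μ) - (∫ z, f z ∂μ) * (∫ z, g z ∂μ))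
    (fun f => Iff.rfl) (fun f g t => rfl) (fun s f g => rfl) (fun x z => rfl) hFI2
    hω hl.le hβ.le hT G (fun s x y => rfl) schur (fun s f g => rfl)
    (fun s hs v hv => hGpos s hs v hv) hs

end Summit.AtomisticToContinuum.FouriersLaw.Theorems.HonestZwanzig.PositiveMemory

end
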